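import Summits.BirchSwinnertonDyer.Rank1Residual.X11b.BDPRouteNoRam
import Summits.BirchSwinnertonDyer.Rank1Residual.AdditivePotMult.RankOneHeegnerAnyPrime
import Literature.NumberTheory.EllipticCurves.MatarNekovar2019.ShaIndexBoundIrreducible
import Literature.NumberTheory.EllipticCurves.NeronIsogenyScalingHoldsProofs
import Summits.BirchSwinnertonDyer.BirchSwinnertonDyer.Theses.ErratumRoadFive
import HarnessLib

/-!
# Route `ErratumRoadFive` (rung K2a), crux 6 = item 19065 `NonSurjCorner` — the localised
# non-surjective corner (T4′) SPLIT INTO HALVES, file 1/2: its Euler-system half is NOT a new residual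
# (cell `bsd-stepL`, seat `bsd-stepL-corner-p1` g0; `--supports stmt-BirchSwinnertonDyer-19065`)

HONEST FRAMING. The crux `NonSurjCorner` types the whole `p`-part `Typed.MissingPPartAt W p` on the
(T4′) corner of class X11b at `p ≥ 5`: `r_an(E) = 1`, `p ∥ N`, `E[p]` irreducible, `ρ̄_{E,p}` NOT onto
(at a multiplicative `p ≥ 5` the image contains the inertial torus `{diag(u,1)}`, so it is the
normaliser of a split Cartan, or the octahedral `5S4` image at `p = 5`), localised by the kernel to
`p ∈ {5,7} ∧ p ∣ ord_p Δ_min ∧ ¬(ram)` (64 class-pairs `N < 5·10⁵`, 5 TRUE-OPEN). Nothing here proves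
that crux. This file records, as kernel theorems, what the PRINTED irreducible-image Kolyvagin bound
buys there (Matar–Nekovář 2019 Thm. 0.3 + §0.11, tree fact
`MatarNekovar2019.thm03_padicValNat_card_sha_le_of_irreducible`: `ord_p #Ш(E/K) ≤ 2·ord_p [E(K):ℤy_K]`
for `d_K ∉ {−3,−4}`, `p ≠ 2`, `E[p]` irreducible — NO surjectivity; on the corner the image has order
prime to `p`, so Lawson–Wuthrich's `H¹(ℚ(E[p])/ℚ, E[p]) = 0` is automatic and §0.11 applies verbatim):

* §1 **the image-free Kolyvagin Tamagawa defect** — additive-p1's class-agnostic tool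
  `AdditivePotMult.padicValNat_shaOrder_le_add_of_rankOne_of_lowerTwists` with its two image binders
  (`hB` = Kolyvagin 1990 ∕ McCallum 1991 §1 for `ρ̄` onto, and `hsurj`) replaced by the Matar–Nekovář
  fact: for `W` of analytic rank one, `p ≥ 5`, `E[p]` IRREDUCIBLE, a Manin-good datum, and the lower
  halves of the rank-`0` Heegner twists in which `p` splits:
  `ord_p #Ш(E) ≤ ord_p #Ш(E)_an + 2·ord_p ∏_ℓ c_ℓ(E)`;
* §2 **the Euler-system half on X11b ∧ ¬(ram) ∧ `p ≥ 5` WITHOUT `Surj`** — multr1-p2's A3 theorem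
  `missingUpperBoundAt_of_classX11b_of_not_ram_of_lowerX11a` with `Surj` dropped: the twist is an X11a
  pair (`classX11a_twist_of_not_ram`), so the route's crux `X11aLowerHalf` (item 19064) feeds it; when
  `p ∣ ∏ c_ℓ` the route's crux `EulerHalfOffLocus` (item 19062 — it carries NO `Surj`) IS the half.
  HENCE THE CORNER'S EULER-SYSTEM HALF IS IN THE CONE OF THE ROUTE'S OWN CRUXES 19062 + 19064, the
  published inputs and ONE more published fact (Matar–Nekovář): `erratumRoadFive_nonSurjCorner_upperHalf`;
* §3 **`NonSurjCorner` ⇐ its main-conjecture half** (typed wholesale in Miller's currency,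
  `Typed.MissingLowerBoundAt` on the corner) ∧ `EulerHalfOffLocus` ∧ `X11aLowerHalf` ∧ published facts:
  `erratumRoadFive_nonSurjCorner_of_lowerHalf`. File 2/2 (`ErratumRoadFiveNonSurjCornerLower.lean`)
  refines the lower half to an open input of the shape of crux `OpenInputIMC` with `Surj ↦ ¬Surj` plus
  the Euler-system half of the rank-`0` twin corner.

What this is NOT: not a proof of `NonSurjCorner` (its main-conjecture half has NO source in print:
every anticyclotomic divisibility at `p ∥ N` — Howard, Castella, Fouquet–Wan — needs an image
containing `SL₂`); nothing is booked; X11b stays CONSTRUCTION-SHAPED; closes nothing. The planner may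
restate crux 19065 as its main-conjecture half.

References: [MatarNekovar2019] Thm. 0.3 (p. 456), §0.4, §0.11 (p. 457), Cor. 5.21 (e′), Prop. 5.26 (2);
[LawsonWuthrich2016] Thm. 1; [JetchevSkinnerWan2017] §7.4.2 (p. 31); [FriedbergHoffstein1995] Thm. B;
[Mazur1978] Cor. 4.1; [Miller2011LMS] Def. 1.1; cell files `BDPRouteNoRam.lean` (A3 atom),
`BDPRouteEndState.lean` §3 (binder `hCorner`), TARGET.md §2 (T4′ = 64 pairs).
-/

noncomputable section

open scoped Classical

open WeierstrassCurve NumberField IsDedekindDomain Field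
open Literature.NumberTheory.EllipticCurves Literature.NumberTheory.EllipticCurves.GreenbergSelmer
  Literature.NumberTheory.EllipticCurves.ModularForms
  Literature.NumberTheory.EllipticCurves.Rank1Residual
  Literature.NumberTheory.EllipticCurves.Rank1Residual.Typed
  Literature.NumberTheory.EllipticCurves.Wuthrich2014
  Literature.NumberTheory.EllipticCurves.BalakrishnanEtAl2019
  Literature.NumberTheory.QuadraticFields.Quadratic
  Literature.NumberTheory.Automorphic
  Literature.NumberTheory.GaloisRepresentations Literature.NumberTheory.GaloisCohomology
  Summit.BirchSwinnertonDyer.Rank1Residual.X11b.AcSelmer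
  Summit.BirchSwinnertonDyer.Rank1Residual.X11b.LocBridge

namespace Summit.BirchSwinnertonDyer.Rank1Residual.X11b

/-! ### §1. The image-free Kolyvagin Tamagawa defect (Matar–Nekovář 2019 in place of Kolyvagin 1990 ∧ `Surj`) -/

/-- **Kolyvagin's Tamagawa defect, rank one, ANY prime `p ≥ 5`, `E[p]` IRREDUCIBLE (no surjectivity),
relative to the rank-zero Heegner twists' lower halves.** For `W/ℚ` globally minimal with
`ord_{s=1} L(E,s) = 1`, a prime `p ≥ 5` with `E[p]` irreducible, and a parametrisation datum `D` at
level `N_E` with `p ∤ c(D)`: IF `MissingLowerBoundAt Wd p` holds for every globally minimal model `Wd`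
of a rank-zero twist `E^{(d_K)}` by an imaginary quadratic `K` satisfying the Heegner hypothesis for
`N_E` AND for `p`, THEN `#Ш(E)_an = q ∈ ℚ` with `ord_p #Ш(E) ≤ ord_p q + 2·ord_p ∏_ℓ c_ℓ(E)`. This is
additive-p1's `AdditivePotMult.padicValNat_shaOrder_le_add_of_rankOne_of_lowerTwists` VERBATIM with the
bound over `K` supplied by Matar–Nekovář 2019 Thm. 0.3 + §0.11 (`hMN`; the Friedberg–Hoffstein field has
`|d_K| > 4`, so `d_K ∉ {−3,−4}`) instead of Kolyvagin 1990 / McCallum 1991 §1 (which needs `ρ̄` onto).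
Binders (published): `hGZ`, `hKo`, `hMN`, `hGZK`, `hmod`, `hnf`, `hFH`. Nothing booked.
[cite: MatarNekovar2019, Thm. 0.3 (p. 456), §0.11 (p. 457), Cor. 5.21 (e′) (pp. 490–491), Prop. 5.26 (2) (p. 492)]
[cite: JetchevSkinnerWan2017, §7.4.2 (p. 31)] [cite: FriedbergHoffstein1995, Thm. B] [cite: Miller2011LMS, Def. 1.1] -/
theorem padicValNat_shaOrder_le_add_of_rankOne_of_lowerTwists_of_matarNekovar
    (hGZ : ∀ (N : ℕ) [NeZero N] (W : WeierstrassCurve ℚ) (K : Type) [Field K] [NumberField K],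
      gross_zagier N W K)
    (hKo : ∀ (N : ℕ) [NeZero N] (W : WeierstrassCurve ℚ) (K : Type) [Field K] [NumberField K],
      kolyvagin N W K)
    (hMN : ∀ (N : ℕ) [NeZero N] (W : WeierstrassCurve ℚ) (K : Type) [Field K] [NumberField K],
      MatarNekovar2019.thm03_padicValNat_card_sha_le_of_irreducible N W K)
    (hGZK : rank_eq_analyticRank_of_analyticRank_le_one) (hmod : hasEntireLFunction_rat)
    (hnf : exists_isNewformOf) (hFH : friedbergHoffstein_exists_heegnerField_split_twist_ne_zero)
    (W : WeierstrassCurve ℚ) [W.IsElliptic] [W.IsGloballyMinimal] (p : ℕ) [Fact p.Prime]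
    [NeZero (W.conductorNorm ℤ)]
    (hirr : Irr W p) (hp5 : 5 ≤ p) (hr : W.analyticRank = 1)
    (D : ModularParametrizationData W (W.conductorNorm ℤ)) (hc : ¬ (p : ℤ) ∣ D.c)
    (hlow : ∀ (K : Type) [Field K] [NumberField K] (Wd : WeierstrassCurve ℚ) [Wd.IsElliptic]
      [Wd.IsGloballyMinimal], IsImaginaryQuadratic K →
      SatisfiesHeegnerHypothesis (W.conductorNorm ℤ) K → SatisfiesHeegnerHypothesis p K →
      (∃ C : VariableChange ℚ, C • W.quadraticTwist (NumberField.discr K : ℚ) = Wd) →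
      Wd.analyticRank = 0 → MissingLowerBoundAt Wd p) :
    ∃ q : ℚ, shaAn W = (q : ℂ) ∧
      (padicValNat p W.shaOrder : ℤ) ≤ padicValRat p q + 2 * padicValNat p W.tamagawaProduct := by
  have hp : p.Prime := Fact.out
  have hp2 : p ≠ 2 := by omega
  have hw : W.rootNumber = -1 := by
    rw [WeierstrassCurve.rootNumber_eq_neg_one_pow_analyticRank_of_exists_isNewformOf hnf W, hr]
    norm_num
  obtain ⟨K, _, _, hK, hdisc, hHN, hHp, hLt⟩ := hFH W hw p hp 4
  haveI : IsTotallyComplex K := hK.2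
  have hneg : NumberField.discr K < 0 := discr_neg_of_finrank_eq_two K hK.1
  have h4 : NumberField.discr K < -4 := by
    have habs : ((NumberField.discr K).natAbs : ℤ) = -NumberField.discr K :=
      Int.ofNat_natAbs_of_nonpos hneg.le
    have : (4 : ℤ) < ((NumberField.discr K).natAbs : ℤ) := by exact_mod_cast hdisc
    omega
  have hD3 : NumberField.discr K ≠ -3 := by omega
  have hD4 : NumberField.discr K ≠ -4 := by omega
  have hμ : ¬ p ∣ Units.torsionOrder K := by
    rw [Literature.NumberTheory.DiophantineGeometry.torsionOrder_eq_two_of_discr_lt hK.1 h4]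
    intro h2
    have := Nat.le_of_dvd two_pos h2
    omega
  obtain ⟨β, hβ⟩ := exists_dvd_sq_sub_discr_holds (W.conductorNorm ℤ) K hK hHN
  obtain ⟨H, -⟩ := nonempty_heegnerDatum_holds (W.conductorNorm ℤ) K hK hβ
  obtain ⟨ι⟩ : Nonempty (K →+* ℂ) := inferInstance
  obtain ⟨P, hP⟩ := heegnerPointComplex_mem_range_map_holds (W.conductorNorm ℤ) W K hK hHN D H ι
  have hD0 : (NumberField.discr K : ℚ) ≠ 0 := by exact_mod_cast NumberField.discr_ne_zero K
  haveI hEt : (W.quadraticTwist (NumberField.discr K : ℚ)).IsElliptic :=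
    W.isElliptic_quadraticTwist hD0
  obtain ⟨Cd, hCd⟩ := hasGlobalMinimalModel_rat_holds (W.quadraticTwist (NumberField.discr K : ℚ))
  haveI : (Cd • W.quadraticTwist (NumberField.discr K : ℚ)).IsGloballyMinimal := hCd
  have hWd : Cd • W.quadraticTwist (NumberField.discr K : ℚ) =
      Cd • W.quadraticTwist (NumberField.discr K : ℚ) := rfl
  have hrd : (Cd • W.quadraticTwist (NumberField.discr K : ℚ)).analyticRank = 0 := by
    rw [analyticRank_smul]
    exact analyticRank_eq_zero_of_entireLFunction_one_ne_zero _ hLt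
  have hlowd := hlow K (Cd • W.quadraticTwist (NumberField.discr K : ℚ)) hK hHN hHp ⟨Cd, rfl⟩ hrd
  exact AdditivePotMult.padicValNat_shaOrder_le_add_of_heegnerData_of_lowerTwist' W p K D H ι P
    (hGZ _ W K) (hKo _ W K) hGZK hmod hr hp5 hirr hK hHN hHp hP hc hμ hLt
    (Cd • W.quadraticTwist (NumberField.discr K : ℚ)) Cd hWd hlowd
    (fun _ hnt ↦ hMN _ W K hK hHN hD3 hD4 ⟨D, H, ι, hP⟩ hnt hp hp2 hirr)

/-- **Kolyvagin's Tamagawa defect on X11b ∧ ¬(ram) ∧ `p ≥ 5`, NO `Surj`, relative to X11a's lower half.**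
For `(E,p)` in X11b with `p ≥ 5` and `¬ Ram W p` (any image — in particular the (T4′) corner): IF the
main-conjecture half `Typed.MissingLowerBoundAt Wd p` holds at every globally minimal `Wd` with
`ClassX11a Wd p` (the rank-`0` sister class at the same `p`; the route's crux `X11aLowerHalf`, item 19064),
THEN `#Ш(E)_an = q ∈ ℚ` with `ord_p #Ш(E) ≤ ord_p q + 2·ord_p ∏_ℓ c_ℓ(E)`. Multr1-p2's
`padicValNat_shaOrder_le_add_of_classX11b_of_not_ram_of_lowerX11a` with `hB ∧ hsurj ↦ hMN` (§1); the Manin-unit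
datum from `p² ∤ N` (`exists_modularParametrizationData_not_dvd`: modularity, Mazur 1978 Cor. 4.1, Néron
scaling — the last a tree theorem); the twists are X11a pairs (`classX11a_twist_of_not_ram`). CONDITIONAL
on `hX11a`; nothing booked. [cite: MatarNekovar2019, Thm. 0.3 (p. 456) and §0.11 (p. 457)]
[cite: JetchevSkinnerWan2017, §7.4.2 (p. 31)] [cite: Mazur1978, Cor. 4.1] [cite: Miller2011LMS, Def. 1.1] -/
theorem padicValNat_shaOrder_le_add_of_classX11b_of_not_ram_of_lowerX11a_of_matarNekovar
    (hGZ : ∀ (N : ℕ) [NeZero N] (W : WeierstrassCurve ℚ) (K : Type) [Field K] [NumberField K],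
      gross_zagier N W K)
    (hKo : ∀ (N : ℕ) [NeZero N] (W : WeierstrassCurve ℚ) (K : Type) [Field K] [NumberField K],
      kolyvagin N W K)
    (hMN : ∀ (N : ℕ) [NeZero N] (W : WeierstrassCurve ℚ) (K : Type) [Field K] [NumberField K],
      MatarNekovar2019.thm03_padicValNat_card_sha_le_of_irreducible N W K)
    (hGZK : rank_eq_analyticRank_of_analyticRank_le_one) (hmod : hasEntireLFunction_rat)
    (hnf : exists_isNewformOf) (hFH : friedbergHoffstein_exists_heegnerField_split_twist_ne_zero)
    (hMaz : mazur_not_dvd_maninConstant_of_odd)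
    (W : WeierstrassCurve ℚ) [W.IsElliptic] [W.IsGloballyMinimal] (p : ℕ) [Fact p.Prime]
    (hX : ClassX11b W p) (hp5 : 5 ≤ p) (hnram : ¬ Ram W p)
    (hX11a : ∀ (Wd : WeierstrassCurve ℚ) [Wd.IsElliptic] [Wd.IsGloballyMinimal],
      ClassX11a Wd p → Typed.MissingLowerBoundAt Wd p) :
    ∃ q : ℚ, shaAn W = (q : ℂ) ∧
      (padicValNat p W.shaOrder : ℤ) ≤ padicValRat p q + 2 * padicValNat p W.tamagawaProduct := by
  have hNS : integral_neronScaling_of_isGloballyMinimal :=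
    integral_neronScaling_of_isGloballyMinimal_holds
  haveI : NeZero (W.conductorNorm ℤ) := ⟨(W.conductorNorm_pos_holds).ne'⟩
  have hp : p.Prime := Fact.out
  have hp2 : p ≠ 2 := by omega
  have hpN : ¬ p ^ 2 ∣ W.conductorNorm ℤ := not_sq_dvd_conductorNorm_of_mult W p hX.2.2.1
  obtain ⟨D, hc⟩ :=
    exists_modularParametrizationData_not_dvd hnf hMaz hNS W rfl hp hp2 hpN hX.2.2.2
  exact padicValNat_shaOrder_le_add_of_rankOne_of_lowerTwists_of_matarNekovar hGZ hKo hMN hGZK hmod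
    hnf hFH W p hX.2.2.2 hp5 hX.1 D hc
    (fun K _ _ Wd _ _ hK hHN _ ⟨C, hC⟩ hrd ↦
      hX11a Wd (classX11a_twist_of_not_ram W p hX hnram K hK hHN C hC hrd))

/-! ### §2. The Euler-system half on X11b ∧ ¬(ram) ∧ `p ≥ 5` without `Surj`; the corner's upper half -/

/-- **The Euler-system half on X11b ∧ ¬(ram) ∧ `p ≥ 5` ∧ `p ∤ ∏ c_ℓ`, NO `Surj`, relative to X11a's
lower half**: `Typed.MissingUpperBoundAt W p` — the defect of
`padicValNat_shaOrder_le_add_of_classX11b_of_not_ram_of_lowerX11a_of_matarNekovar` vanishes. CONDITIONAL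
on `hX11a`. [cite: MatarNekovar2019, Thm. 0.3 (p. 456) and §0.11 (p. 457)] [cite: Miller2011LMS, Def. 1.1] -/
theorem missingUpperBoundAt_of_classX11b_of_not_ram_of_lowerX11a_of_matarNekovar
    (hGZ : ∀ (N : ℕ) [NeZero N] (W : WeierstrassCurve ℚ) (K : Type) [Field K] [NumberField K],
      gross_zagier N W K)
    (hKo : ∀ (N : ℕ) [NeZero N] (W : WeierstrassCurve ℚ) (K : Type) [Field K] [NumberField K],
      kolyvagin N W K)
    (hMN : ∀ (N : ℕ) [NeZero N] (W : WeierstrassCurve ℚ) (K : Type) [Field K] [NumberField K],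
      MatarNekovar2019.thm03_padicValNat_card_sha_le_of_irreducible N W K)
    (hGZK : rank_eq_analyticRank_of_analyticRank_le_one) (hmod : hasEntireLFunction_rat)
    (hnf : exists_isNewformOf) (hFH : friedbergHoffstein_exists_heegnerField_split_twist_ne_zero)
    (hMaz : mazur_not_dvd_maninConstant_of_odd)
    (W : WeierstrassCurve ℚ) [W.IsElliptic] [W.IsGloballyMinimal] (p : ℕ) [Fact p.Prime]
    (hX : ClassX11b W p) (hp5 : 5 ≤ p) (hnram : ¬ Ram W p) (htam : ¬ p ∣ W.tamagawaProduct)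
    (hX11a : ∀ (Wd : WeierstrassCurve ℚ) [Wd.IsElliptic] [Wd.IsGloballyMinimal],
      ClassX11a Wd p → Typed.MissingLowerBoundAt Wd p) :
    Typed.MissingUpperBoundAt W p := by
  obtain ⟨q, hq, hle⟩ :=
    padicValNat_shaOrder_le_add_of_classX11b_of_not_ram_of_lowerX11a_of_matarNekovar hGZ hKo hMN
      hGZK hmod hnf hFH hMaz W p hX hp5 hnram hX11a
  refine ⟨q, hq, ?_⟩
  rw [padicValNat.eq_zero_of_not_dvd htam, Nat.cast_zero, mul_zero, add_zero] at hle
  exact hle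

/-- **The Euler-system half `ord_p #Ш(E) ≤ ord_p #Ш(E)_an` on ALL of X11b ∧ ¬(ram) ∧ `p ≥ 5` — in
particular on the (T4′) non-surjective corner — from the route's own residues.** Inputs at the pair:
`hEu` — the typed half ITSELF when `p ∣ ∏_ℓ c_ℓ(E)` (the body of crux `EulerHalfOffLocus`, item 19062,
on its `¬Ram` branch — that crux carries no `Surj`); `hX11a` — the main-conjecture half on X11a at `p`
(crux `X11aLowerHalf`, item 19064); when `p ∤ ∏ c_ℓ` the previous theorem (Matar–Nekovář). NO `Surj`, NO
new typed input. CONDITIONAL on the two cruxes; nothing booked.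
[cite: MatarNekovar2019, Thm. 0.3 (p. 456) and §0.11 (p. 457)] [cite: JetchevSkinnerWan2017, §7.4.2 (p. 31)]
[cite: Miller2011LMS, Def. 1.1] -/
theorem missingUpperBoundAt_of_classX11b_of_not_ram_of_eulerHalf_of_lowerX11a
    (hGZ : ∀ (N : ℕ) [NeZero N] (W : WeierstrassCurve ℚ) (K : Type) [Field K] [NumberField K],
      gross_zagier N W K)
    (hKo : ∀ (N : ℕ) [NeZero N] (W : WeierstrassCurve ℚ) (K : Type) [Field K] [NumberField K],
      kolyvagin N W K)
    (hMN : ∀ (N : ℕ) [NeZero N] (W : WeierstrassCurve ℚ) (K : Type) [Field K] [NumberField K],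
      MatarNekovar2019.thm03_padicValNat_card_sha_le_of_irreducible N W K)
    (hGZK : rank_eq_analyticRank_of_analyticRank_le_one) (hmod : hasEntireLFunction_rat)
    (hnf : exists_isNewformOf) (hFH : friedbergHoffstein_exists_heegnerField_split_twist_ne_zero)
    (hMaz : mazur_not_dvd_maninConstant_of_odd)
    (W : WeierstrassCurve ℚ) [W.IsElliptic] [W.IsGloballyMinimal] (p : ℕ) [Fact p.Prime]
    (hX : ClassX11b W p) (hp5 : 5 ≤ p) (hnram : ¬ Ram W p)
    (hEu : p ∣ W.tamagawaProduct → Typed.MissingUpperBoundAt W p)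
    (hX11a : ∀ (Wd : WeierstrassCurve ℚ) [Wd.IsElliptic] [Wd.IsGloballyMinimal],
      ClassX11a Wd p → Typed.MissingLowerBoundAt Wd p) :
    Typed.MissingUpperBoundAt W p := by
  by_cases htam : p ∣ W.tamagawaProduct
  · exact hEu htam
  · exact missingUpperBoundAt_of_classX11b_of_not_ram_of_lowerX11a_of_matarNekovar hGZ hKo hMN hGZK
      hmod hnf hFH hMaz W p hX hp5 hnram htam hX11a

end Summit.BirchSwinnertonDyer.Rank1Residual.X11b

/-! ### §3. `NonSurjCorner` from its main-conjecture half (the Euler-system half is in the route's cone) -/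

namespace Summit.BirchSwinnertonDyer.Rank1Residual.X11b

open Summit.BirchSwinnertonDyer.BirchSwinnertonDyer.Theses.ErratumRoadFive

/-- **The Euler-system half of crux `NonSurjCorner` (item 19065) is in the cone of cruxes
`EulerHalfOffLocus` (19062) and `X11aLowerHalf` (19064).** For every `(E,p)` on the localised
non-surjective corner (`ClassX11b W p`, `¬ Surj W p`, `p ∈ {5,7}`, `p ∣ ord_p Δ_min`, `¬ Ram W p`):
`Typed.MissingUpperBoundAt W p` from the published named facts Gross–Zagier, Kolyvagin, **Matar–Nekovář
2019 Thm. 0.3 + §0.11** (`hMN`, NOT among the fifteen of `PublishedInputsFive`), GZK, modularity ×2,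
Friedberg–Hoffstein (split field), Mazur 1978 Cor. 4.1, and the two cruxes BY NAME (`h₂` on its `¬Ram`
branch when `p ∣ ∏ c_ℓ`; `h₄` for the Heegner twists, which are X11a pairs). `¬ Surj` and
`p ∣ ord_p Δ_min` are not used (the statement holds on all of X11b ∧ ¬(ram) ∧ `p ≥ 5`). CONDITIONAL on
the two cruxes; nothing booked. [cite: MatarNekovar2019, Thm. 0.3 (p. 456) and §0.11 (p. 457)]
[cite: JetchevSkinnerWan2017, §7.4.2 (p. 31)] [cite: Miller2011LMS, Def. 1.1] -/
theorem erratumRoadFive_nonSurjCorner_upperHalf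
    (hGZ : ∀ (N : ℕ) [NeZero N] (W : WeierstrassCurve ℚ) (K : Type) [Field K] [NumberField K],
      gross_zagier N W K)
    (hKo : ∀ (N : ℕ) [NeZero N] (W : WeierstrassCurve ℚ) (K : Type) [Field K] [NumberField K],
      kolyvagin N W K)
    (hMN : ∀ (N : ℕ) [NeZero N] (W : WeierstrassCurve ℚ) (K : Type) [Field K] [NumberField K],
      MatarNekovar2019.thm03_padicValNat_card_sha_le_of_irreducible N W K)
    (hGZK : rank_eq_analyticRank_of_analyticRank_le_one) (hmod : hasEntireLFunction_rat)
    (hnf : exists_isNewformOf) (hFHs : friedbergHoffstein_exists_heegnerField_split_twist_ne_zero)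
    (hMaz : mazur_not_dvd_maninConstant_of_odd)
    (h₂ : Summit.BirchSwinnertonDyer.BirchSwinnertonDyer.Theses.ErratumRoadFive.EulerHalfOffLocus)
    (h₄ : Summit.BirchSwinnertonDyer.BirchSwinnertonDyer.Theses.ErratumRoadFive.X11aLowerHalf) :
    ∀ (W : WeierstrassCurve ℚ) [W.IsElliptic] [W.IsGloballyMinimal] (p : ℕ) [Fact p.Prime],
      ClassX11b W p → ¬ Surj W p → (p = 5 ∨ p = 7) → p ∣ padicValInt p W.minimalDiscriminantInt →
      ¬ Ram W p → Typed.MissingUpperBoundAt W p := by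
  intro W _ _ p _ hX _ h57 _ hnr
  have hp5 : 5 ≤ p := by rcases h57 with h | h <;> omega
  exact missingUpperBoundAt_of_classX11b_of_not_ram_of_eulerHalf_of_lowerX11a hGZ hKo hMN hGZK hmod
    hnf hFHs hMaz W p hX hp5 hnr (fun htam ↦ h₂ W p hX hp5 htam (Or.inl hnr))
    (fun Wd _ _ hXa ↦ h₄ Wd p hXa)

/-- **Crux `NonSurjCorner` (item 19065) from its MAIN-CONJECTURE HALF alone.** IF the main-conjecture
half `Typed.MissingLowerBoundAt W p` (`ord_p #Ш(E)_an ≤ ord_p #Ш(E)`, Miller's currency) holds at every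
pair of the localised non-surjective corner (`hL` — typed; NO source in print), THEN — given the cruxes
`EulerHalfOffLocus` (`h₂`, item 19062) and `X11aLowerHalf` (`h₄`, item 19064) of the same route and the
published named facts Gross–Zagier, Kolyvagin, Matar–Nekovář 2019, GZK, modularity ×2,
Friedberg–Hoffstein, Mazur 1978 Cor. 4.1 — the route decl
`Summit.BirchSwinnertonDyer.BirchSwinnertonDyer.Theses.ErratumRoadFive.NonSurjCorner` holds: the two
halves make the whole (`Typed.missingPPartAt_of_lower_of_upper`), the Euler-system half being
`erratumRoadFive_nonSurjCorner_upperHalf`. CONDITIONAL on `hL`, `h₂`, `h₄`; does NOT close item 19065;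
nothing booked. [cite: MatarNekovar2019, Thm. 0.3 (p. 456) and §0.11 (p. 457)]
[cite: JetchevSkinnerWan2017, §7.4.1–7.4.2 (pp. 30–31)] [cite: Miller2011LMS, Def. 1.1] -/
theorem erratumRoadFive_nonSurjCorner_of_lowerHalf
    (hGZ : ∀ (N : ℕ) [NeZero N] (W : WeierstrassCurve ℚ) (K : Type) [Field K] [NumberField K],
      gross_zagier N W K)
    (hKo : ∀ (N : ℕ) [NeZero N] (W : WeierstrassCurve ℚ) (K : Type) [Field K] [NumberField K],
      kolyvagin N W K)
    (hMN : ∀ (N : ℕ) [NeZero N] (W : WeierstrassCurve ℚ) (K : Type) [Field K] [NumberField K],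
      MatarNekovar2019.thm03_padicValNat_card_sha_le_of_irreducible N W K)
    (hGZK : rank_eq_analyticRank_of_analyticRank_le_one) (hmod : hasEntireLFunction_rat)
    (hnf : exists_isNewformOf) (hFHs : friedbergHoffstein_exists_heegnerField_split_twist_ne_zero)
    (hMaz : mazur_not_dvd_maninConstant_of_odd)
    (h₂ : Summit.BirchSwinnertonDyer.BirchSwinnertonDyer.Theses.ErratumRoadFive.EulerHalfOffLocus)
    (h₄ : Summit.BirchSwinnertonDyer.BirchSwinnertonDyer.Theses.ErratumRoadFive.X11aLowerHalf)
    -- the main-conjecture half on the localised corner (typed; no source)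
    (hL : ∀ (W : WeierstrassCurve ℚ) [W.IsElliptic] [W.IsGloballyMinimal] (p : ℕ) [Fact p.Prime],
      ClassX11b W p → ¬ Surj W p → (p = 5 ∨ p = 7) → p ∣ padicValInt p W.minimalDiscriminantInt →
      ¬ Ram W p → Typed.MissingLowerBoundAt W p) :
    Summit.BirchSwinnertonDyer.BirchSwinnertonDyer.Theses.ErratumRoadFive.NonSurjCorner := by
  intro W _ _ p _ hX hns h57 hv hnr
  exact Typed.missingPPartAt_of_lower_of_upper W p (hL W p hX hns h57 hv hnr)
    (erratumRoadFive_nonSurjCorner_upperHalf hGZ hKo hMN hGZK hmod hnf hFHs hMaz h₂ h₄ W p hX hns h57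
      hv hnr)

end Summit.BirchSwinnertonDyer.Rank1Residual.X11b

end
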